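import Summits.ResolutionOfSingularities.ResolutionOfSingularities.Theorems.InvariantDescentLU
import HarnessLib

/-!
# InvariantDescentLU2 — decomp-res node «InvariantDescent (lens-1 g28 prep C = ENGINE-2; critic letter row 216a
LANDABLE AT 0, banked toward (W-α) WHOLE)», tree file 2/2 of the node

Continuation of the decomp-res lens-1 g28 file `HOME/decomp-res-lens-1/g28/land/InvariantDescentLU.lean` (sha256
427ce96f; HOME = run/shared/lean/pub/decomp-res), critic letter row 216a LANDABLE AT 0 — provenance and the lens
header in full in the first file of the node, `InvariantDescentLU`. Namespace `…Theorems.InvariantDescentLU`;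
`--supports stmt-ResolutionOfSingularities-0641 --as helper`.

## This file

Continuation 2/2 of `InvariantDescentLU` (same namespace and sections of the node, cut at the tree's 400-line cap;
section variables / opens replayed): `section Normal`, `section Main`, `section ArtinTate` — carries
`isIntegrallyClosed_locAtCentre_inf`, `exists_fraction_closure`, `isRegularLocalRing_locAtCentre_inf_fixed`,
`exists_finset_inf_fixed_eq_closure`, `isNoetherianRing_inf_fixed`, `isRegularLocalRing_locAtCentre_inf_fixed_of_fg`.

[WRITER NOTE (decomp-res writer g13): file split only (tree files ≤ 400 lines); namespace, sections, section
variables / opens and every declaration exactly as in the lens file (the `universe u` line moved to the preamble).]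

(Sources: Matsumura1987, Thm. 23.7 (i), Thm. 19.4; AtiyahMacdonald1969, Prop. 7.8 (Artin–Tate) via Mathlib
`fg_of_fg_of_fg`; folklore invariant theory of finite groups; tree: InertDescentLU (g28 PART A/B).)
-/

open Polynomial Literature.AlgebraicGeometry.Resolution
open Summit.ResolutionOfSingularities.ResolutionOfSingularities.Theorems.InertDescentLU

universe u

namespace Summit.ResolutionOfSingularities.ResolutionOfSingularities.Theorems.InvariantDescentLU

variable {E : Type u} [Field E] (OE : ValuationSubring E)

section Normal

variable {H : Finset (E ≃+* E)} {K : Subfield E} {T₁ : Subring E}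

/-- **The invariant local ring `B = (T₁ ∩ K)_𝔪` is integrally closed** when `(T₁)_𝔪′` is regular and
`Frac T₁ = E` (no stability of `O_E` under `H` needed): an element of `K = Frac B` integral over `B` is
integral over the regular (hence normal) `(T₁)_𝔪′`, so lies in `(T₁)_𝔪′ ∩ K ⊆ B`.
(Sources: Matsumura1987 Thm. 19.4 via the tree.) -/
theorem isIntegrallyClosed_locAtCentre_inf (h1 : (1 : E ≃+* E) ∈ H)
    (hmul : ∀ g ∈ H, ∀ h ∈ H, g * h ∈ H) (hK : ∀ z, z ∈ K ↔ ∀ h ∈ H, h z = z)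
    (hT₁O : T₁ ≤ OE.toSubring) (hT₁H : ∀ h ∈ H, ∀ z ∈ T₁, h z ∈ T₁)
    (hfrac : ∀ z : E, ∃ a ∈ T₁, ∃ b ∈ T₁, b ≠ 0 ∧ z = a / b)
    (hreg : IsRegularLocalRing (locAtCentre T₁ OE)) :
    IsIntegrallyClosed (locAtCentre (T₁ ⊓ K.toSubring) OE) := by
  set B : Subring E := locAtCentre (T₁ ⊓ K.toSubring) OE with hBdef
  set A₁ : Subring E := locAtCentre T₁ OE with hA₁def
  haveI : IsRegularLocalRing A₁ := hreg
  haveI : IsIntegrallyClosed A₁ := isIntegrallyClosed_of_isRegularLocalRing A₁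
  have hBA₁ : B ≤ A₁ := locAtCentre_mono OE inf_le_left
  have hTK : T₁ ⊓ K.toSubring ≤ K.toSubring := inf_le_right
  have hBK : B ≤ K.toSubring := locAtCentre_le_subfield _ OE K hTK
  have hA₁frac : ∀ z : E, ∃ a ∈ A₁, ∃ b ∈ A₁, b ≠ 0 ∧ z = a / b := fun z => by
    obtain ⟨a, ha, b, hb, hb0, hz⟩ := hfrac z
    exact ⟨a, le_locAtCentre _ _ ha, b, le_locAtCentre _ _ hb, hb0, hz⟩
  -- the key inclusion: elements of `K` integral over `B` lie in `B`
  have hnorm : ∀ z ∈ K, IsIntegral B z → z ∈ B := fun z hzK hz =>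
    mem_locAtCentre_inf_of_fixed OE h1 hmul hK hT₁O hT₁H
      (mem_of_isIntegral_of_isIntegrallyClosed A₁ hA₁frac
        (by -- the lens's helper `isIntegral_of_le`, inlined (its statement is the landed
            -- `DecompositionDescentLU.isIntegral_of_subring_le`; see the writer note in `InvariantDescentLU`)
            obtain ⟨p, hp, hpz⟩ := hz
            refine ⟨p.map (Subring.inclusion hBA₁), hp.map _, ?_⟩
            rw [eval₂_map]
            exact hpz))
      ((hK z).mp hzK)
  -- `K` as the fraction field of `B`
  let L : Type u := K
  letI : Algebra B L := ((B.subtype).codRestrict K (fun b => hBK b.2)).toAlgebra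
  haveI : IsScalarTower B L E := IsScalarTower.of_algebraMap_eq fun _ => rfl
  have hinj : Function.Injective (algebraMap B L) := fun a b hab => by
    apply Subtype.ext
    have := congrArg (fun z : L => (z : E)) hab
    exact this
  haveI : FaithfulSMul B L := (faithfulSMul_iff_algebraMap_injective B L).mpr hinj
  haveI : IsFractionRing B L := by
    refine IsFractionRing.of_field B L fun z => ?_
    obtain ⟨a, ha, b, hb, -, hz⟩ := exists_fraction_of_mem_fixed h1 hmul hK hT₁H hfrac z.2
    exact ⟨⟨a, le_locAtCentre _ _ ha⟩, ⟨b, le_locAtCentre _ _ hb⟩, Subtype.ext hz⟩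
  refine (isIntegrallyClosed_iff L).mpr (fun {y} hy => ?_)
  have hyE : IsIntegral B (y : E) := hy.map (IsScalarTower.toAlgHom B L E)
  exact ⟨⟨(y : E), hnorm y y.2 hyE⟩, Subtype.ext rfl⟩

end Normal

section Main

variable (H : Finset (E ≃+* E)) (K : Subfield E) (T₁ : Subring E)

/-! ### S5. THE DESCENT THEOREM -/

/-- Every element of `E = K[x]` is a fraction of elements of `(T₁ ∩ K)[x]` (`K = Frac (T₁ ∩ K)`).
[folklore] -/
theorem exists_fraction_closure (h1 : (1 : E ≃+* E) ∈ H) (hmul : ∀ g ∈ H, ∀ h ∈ H, g * h ∈ H)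
    (hK : ∀ z, z ∈ K ↔ ∀ h ∈ H, h z = z) (hT₁H : ∀ h ∈ H, ∀ z ∈ T₁, h z ∈ T₁)
    (hfrac : ∀ z : E, ∃ a ∈ T₁, ∃ b ∈ T₁, b ≠ 0 ∧ z = a / b) {x : E}
    (hgen : ∀ z : E, ∃ p : E[X], (∀ i, p.coeff i ∈ K) ∧ z = p.eval x) (z : E) :
    ∃ a ∈ Subring.closure (((T₁ ⊓ K.toSubring : Subring E) : Set E) ∪ {x}),
      ∃ b ∈ Subring.closure (((T₁ ⊓ K.toSubring : Subring E) : Set E) ∪ {x}), b ≠ 0 ∧ z = a / b := by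
  set C : Subring E := Subring.closure (((T₁ ⊓ K.toSubring : Subring E) : Set E) ∪ {x}) with hCdef
  have hTC : T₁ ⊓ K.toSubring ≤ C := fun w hw => Subring.subset_closure (Or.inl hw)
  have hxC : x ∈ C := Subring.subset_closure (Or.inr rfl)
  -- `z` lies in the subfield generated by `C`
  have hzF : z ∈ Subfield.closure (C : Set E) := by
    obtain ⟨p, hp, rfl⟩ := hgen z
    rw [eval_eq_sum_range]
    refine Subfield.sum_mem _ fun i _ => Subfield.mul_mem _ ?_
      (Subfield.pow_mem _ (Subfield.subset_closure hxC) i)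
    obtain ⟨a, ha, b, hb, -, he⟩ := exists_fraction_of_mem_fixed h1 hmul hK hT₁H hfrac (hp i)
    rw [he]
    exact Subfield.div_mem _ (Subfield.subset_closure (hTC ha)) (Subfield.subset_closure (hTC hb))
  obtain ⟨y, hy, w, hw, hyw⟩ := Subfield.mem_closure_iff.mp hzF
  rw [Subring.closure_eq] at hy hw
  by_cases hw0 : w = 0
  · refine ⟨0, C.zero_mem, 1, C.one_mem, one_ne_zero, ?_⟩
    rw [← hyw, hw0, div_zero, zero_div]
  · exact ⟨y, hy, w, hw, hw0, hyw.symm⟩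

/-- **INVARIANT DESCENT OF REGULARITY THROUGH ONE SEPARATING WITNESS.**  `H` a finite group of
automorphisms of the field `E` (NOT assumed to preserve the valuation ring `O_E`: the centre may split),
`K = E^H`, `T₁ ⊆ O_E` an `H`-stable subring with `Frac T₁ = E` whose local ring at the centre of `O_E` is
regular, `x ∈ T₁` with `v(x − h x) = 0` for all `h ≠ 1` in `H` (a separating witness: it forces trivial
inertia at the centre) and `E = K[x]`; if the local ring of `T₁ ∩ K` at the centre is Noetherian, it is
REGULAR. (Sources: Matsumura1987 Thm. 23.7 (i), Thm. 19.4 — via g28's `InertDescentLU` PART A/B.) -/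
theorem isRegularLocalRing_locAtCentre_inf_fixed (h1 : (1 : E ≃+* E) ∈ H)
    (hmul : ∀ g ∈ H, ∀ h ∈ H, g * h ∈ H) (hK : ∀ z, z ∈ K ↔ ∀ h ∈ H, h z = z)
    (hT₁O : T₁ ≤ OE.toSubring) (hT₁H : ∀ h ∈ H, ∀ z ∈ T₁, h z ∈ T₁)
    (hfrac : ∀ z : E, ∃ a ∈ T₁, ∃ b ∈ T₁, b ≠ 0 ∧ z = a / b)
    (hreg : IsRegularLocalRing (locAtCentre T₁ OE))
    [IsNoetherianRing (locAtCentre (T₁ ⊓ K.toSubring) OE)]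
    {x : E} (hx : x ∈ T₁) (hsep : ∀ h ∈ H, h ≠ 1 → OE.valuation (x - h x) = 1)
    (hgen : ∀ z : E, ∃ p : E[X], (∀ i, p.coeff i ∈ K) ∧ z = p.eval x) :
    IsRegularLocalRing (locAtCentre (T₁ ⊓ K.toSubring) OE) := by
  classical
  set T : Subring E := T₁ ⊓ K.toSubring with hTdef
  have hTT₁ : T ≤ T₁ := inf_le_left
  have hTO : T ≤ OE.toSubring := hTT₁.trans hT₁O
  have hxO : x ∈ OE := hT₁O hx
  -- coefficients of characteristic polynomials lie in the invariant ring `T`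
  have hcoeffT : ∀ t ∈ T₁, ∀ i, (charPoly H t).coeff i ∈ T := fun t ht i =>
    Subring.mem_inf.mpr ⟨charPoly_coeff_mem H (fun h hh => hT₁H h hh t ht) i,
      (hK _).mpr fun g hg => apply_coeff_charPoly H hmul hg t i⟩
  -- (1) the invariant local ring `B = T_𝔪` is normal
  have hic : IsIntegrallyClosed (locAtCentre T OE) :=
    isIntegrallyClosed_locAtCentre_inf OE h1 hmul hK hT₁O hT₁H hfrac hreg
  -- (2) `x` is ONE standard-étale witness over `B`
  have hfm : (charPoly H x).Monic := charPoly_monic H x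
  have hfx : (charPoly H x).eval x = 0 := charPoly_eval_self H h1 x
  have hder : OE.valuation ((derivative (charPoly H x)).eval x) = 1 := by
    rw [eval_derivative_charPoly H h1, map_prod]
    exact Finset.prod_eq_one fun h hh =>
      hsep h (Finset.mem_of_mem_erase hh) (Finset.ne_of_mem_erase hh)
  -- (3) g28 PART B: `(B[x])_𝔪′` is normal
  have hicx := isIntegrallyClosed_locAtCentre_adjoin OE hTO hxO hic (hcoeffT x hx) hfm hfx hder
  rw [locAtCentre_adjoin_toSubring_eq] at hicx
  -- (4) `(B[x])_𝔪′ = (T₁)_𝔪′`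
  set C : Subring E := Subring.closure ((T : Set E) ∪ {x}) with hCdef
  have hTC : T ≤ C := fun w hw => Subring.subset_closure (Or.inl hw)
  have hCT₁ : C ≤ T₁ := by
    refine Subring.closure_le.mpr ?_
    rintro w (hw | hw)
    · exact hTT₁ hw
    · rw [Set.mem_singleton_iff] at hw; rw [hw]; exact hx
  have hCfrac : ∀ z : E, ∃ a ∈ locAtCentre C OE, ∃ b ∈ locAtCentre C OE, b ≠ 0 ∧ z = a / b := by
    intro z
    obtain ⟨a, ha, b, hb, hb0, hz⟩ := exists_fraction_closure H K T₁ h1 hmul hK hT₁H hfrac hgen z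
    exact ⟨a, le_locAtCentre _ _ ha, b, le_locAtCentre _ _ hb, hb0, hz⟩
  have hT₁C : T₁ ≤ locAtCentre C OE := by
    intro t ht
    haveI := hicx
    refine mem_of_isIntegral_of_isIntegrallyClosed (locAtCentre C OE) hCfrac ?_
    exact isIntegral_locAtCentre_of_le OE hTC
      (isIntegral_of_monic_root T (hcoeffT t ht) (charPoly_monic H t) (charPoly_eval_self H h1 t))
  have hCeq : locAtCentre C OE = locAtCentre T₁ OE := by
    refine le_antisymm (locAtCentre_mono OE hCT₁) ?_
    calc locAtCentre T₁ OE ≤ locAtCentre (locAtCentre C OE) OE := locAtCentre_mono OE hT₁C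
      _ = locAtCentre C OE := locAtCentre_locAtCentre C OE
  have hreg' : IsRegularLocalRing
      (locAtCentre (Algebra.adjoin (locAtCentre T OE) ({x} : Set E)).toSubring OE) := by
    rw [locAtCentre_adjoin_toSubring_eq, ← hCdef, hCeq]
    exact hreg
  -- (5) g28 PART A: regularity descends to `B`
  have hint : IsIntegral (locAtCentre T OE) x :=
    isIntegral_locAtCentre_of_le OE le_rfl (isIntegral_of_monic_root T (hcoeffT x hx) hfm hfx)
  exact isRegularLocalRing_of_adjoin_integral OE hTO hxO hic hint hreg'

end Main

section ArtinTate

variable (H : Finset (E ≃+* E)) (K : Subfield E) (T₁ : Subring E)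

/-! ### S6. The invariant ring is again a MODEL: finite generation (Artin–Tate) and Noetherianity -/

/-- **Artin–Tate for the invariant ring.** If `T₁ = S₀[t₀]` is finitely generated over a Noetherian subring
`S₀` of the fixed field and `H`-stable, the invariant ring `T₁ ∩ K` is finitely generated over `S₀`:
`T₁ ∩ K = S₀[t]` for a finite `t` (so it is again a model). `T₁` is integral over `T₁ ∩ K` (characteristic
polynomials) and of finite type, so module-finite; Artin–Tate (Atiyah–Macdonald Prop. 7.8, Mathlib
`fg_of_fg_of_fg`) gives finite generation of the invariants. [folklore] -/
theorem exists_finset_inf_fixed_eq_closure (h1 : (1 : E ≃+* E) ∈ H)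
    (hmul : ∀ g ∈ H, ∀ h ∈ H, g * h ∈ H) (hK : ∀ z, z ∈ K ↔ ∀ h ∈ H, h z = z)
    (hT₁H : ∀ h ∈ H, ∀ z ∈ T₁, h z ∈ T₁) (S₀ : Subring E) [IsNoetherianRing S₀]
    (hS₀K : S₀ ≤ K.toSubring) (t₀ : Finset E) (hT₁gen : T₁ = Subring.closure ((S₀ : Set E) ∪ t₀)) :
    ∃ t : Finset E, (↑t : Set E) ⊆ (T₁ ⊓ K.toSubring : Subring E) ∧
      (T₁ ⊓ K.toSubring : Subring E) = Subring.closure ((S₀ : Set E) ∪ t) := by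
  classical
  set T : Subring E := T₁ ⊓ K.toSubring with hTdef
  have hS₀T₁ : S₀ ≤ T₁ := by
    rw [hT₁gen]; exact fun z hz => Subring.subset_closure (Or.inl hz)
  have ht₀T₁ : (↑t₀ : Set E) ⊆ T₁ := by
    rw [hT₁gen]; exact fun z hz => Subring.subset_closure (Or.inr hz)
  have hS₀T : S₀ ≤ T := le_inf hS₀T₁ hS₀K
  have hTT₁ : T ≤ T₁ := inf_le_left
  letI : Algebra S₀ T := (Subring.inclusion hS₀T).toAlgebra
  letI : Algebra T T₁ := (Subring.inclusion hTT₁).toAlgebra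
  letI : Algebra S₀ T₁ := (Subring.inclusion hS₀T₁).toAlgebra
  haveI : IsScalarTower S₀ T T₁ := IsScalarTower.of_algebraMap_eq fun _ => rfl
  -- the generators, as elements of `T₁`
  set t₁ : Finset T₁ := t₀.subtype (· ∈ T₁) with ht₁def
  -- `T₁` is generated by `t₁` over any intermediate subring `S₀ ⊆ R ⊆ T₁`
  have key : ∀ (R : Subring E) (hRT₁ : R ≤ T₁), S₀ ≤ R →
      (letI : Algebra R T₁ := (Subring.inclusion hRT₁).toAlgebra
       Algebra.adjoin R ((t₁ : Finset T₁) : Set T₁) = ⊤) := by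
    intro R hRT₁ hS₀R
    letI : Algebra R T₁ := (Subring.inclusion hRT₁).toAlgebra
    refine Algebra.eq_top_iff.mpr fun y => ?_
    set Q : Subring E := (Algebra.adjoin R ((t₁ : Finset T₁) : Set T₁)).toSubring.map T₁.subtype
      with hQdef
    have hT₁Q : T₁ ≤ Q := by
      rw [hT₁gen]
      refine Subring.closure_le.mpr ?_
      rintro z (hz | hz)
      · exact Subring.mem_map.mpr ⟨algebraMap R T₁ ⟨z, hS₀R hz⟩, Subalgebra.algebraMap_mem _ _, rfl⟩
      · refine Subring.mem_map.mpr ⟨⟨z, ht₀T₁ hz⟩, Algebra.subset_adjoin ?_, rfl⟩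
        rw [Finset.mem_coe, ht₁def, Finset.mem_subtype]
        exact hz
    obtain ⟨y', hy', hyy'⟩ := Subring.mem_map.mp (hT₁Q y.2)
    have : y' = y := Subtype.ext hyy'
    rw [← this]
    exact hy'
  -- every element of `T₁` is integral over `T` (root of its characteristic polynomial)
  have hint : ∀ y : T₁, IsIntegral T y := fun y => by
    have hcoeff : ∀ i, (charPoly H (y : E)).coeff i ∈ T := fun i =>
      Subring.mem_inf.mpr ⟨charPoly_coeff_mem H (fun h hh => hT₁H h hh _ y.2) i,
        (hK _).mpr fun g hg => apply_coeff_charPoly H hmul hg _ i⟩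
    obtain ⟨f₀, hf₀, hf₀m⟩ := exists_map_eq_of_coeff_mem_subring T hcoeff (charPoly_monic H _)
    refine ⟨f₀, hf₀m, Subtype.ext ?_⟩
    show (T₁.subtype) (eval₂ (algebraMap T T₁) y f₀) = ((0 : T₁) : E)
    rw [Polynomial.hom_eval₂, ZeroMemClass.coe_zero]
    have hcomp : (T₁.subtype).comp (algebraMap T T₁) = algebraMap T E := RingHom.ext fun _ => rfl
    rw [hcomp, ← eval_map, hf₀]
    exact charPoly_eval_self H h1 _
  -- Artin–Tate
  have hAC : (⊤ : Subalgebra S₀ T₁).FG := ⟨t₁, key S₀ hS₀T₁ le_rfl⟩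
  have hBC : (⊤ : Submodule T T₁).FG := by
    have hfg : (Algebra.adjoin T ((t₁ : Finset T₁) : Set T₁)).toSubmodule.FG :=
      fg_adjoin_of_finite t₁.finite_toSet fun y _ => hint y
    rwa [key T hTT₁ hS₀T, Algebra.top_toSubmodule] at hfg
  have hBCi : Function.Injective (algebraMap T T₁) := fun a b hab =>
    Subtype.ext (congrArg (fun z : T₁ => (z : E)) hab)
  have hfgT : (⊤ : Subalgebra S₀ T).FG := fg_of_fg_of_fg (A := S₀) (B := T) (C := T₁) hAC hBC hBCi
  obtain ⟨t', ht'⟩ := hfgT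
  refine ⟨t'.image (fun y : T => (y : E)), ?_, le_antisymm ?_ ?_⟩
  · intro z hz
    obtain ⟨y, -, rfl⟩ := Finset.mem_image.mp (Finset.mem_coe.mp hz)
    exact y.2
  · intro z hz
    let S' : Subalgebra S₀ T :=
      { (Subring.closure ((S₀ : Set E) ∪ ↑(t'.image (fun y : T => (y : E))))).comap T.subtype with
        algebraMap_mem' := fun r => Subring.subset_closure (Or.inl r.2) }
    have hle : Algebra.adjoin S₀ (t' : Set T) ≤ S' := Algebra.adjoin_le fun y hy =>
      Subring.subset_closure (Or.inr (by
        rw [Finset.coe_image]; exact ⟨y, hy, rfl⟩))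
    have hz' : (⟨z, hz⟩ : T) ∈ S' := hle (by rw [ht']; exact Algebra.mem_top)
    exact hz'
  · refine Subring.closure_le.mpr ?_
    rintro z (hz | hz)
    · exact hS₀T hz
    · obtain ⟨y, -, rfl⟩ := Finset.mem_image.mp (Finset.mem_coe.mp hz)
      exact y.2

/-- **The invariant ring is Noetherian** (a finitely generated algebra over the Noetherian `S₀`).
[folklore] -/
theorem isNoetherianRing_inf_fixed (h1 : (1 : E ≃+* E) ∈ H)
    (hmul : ∀ g ∈ H, ∀ h ∈ H, g * h ∈ H) (hK : ∀ z, z ∈ K ↔ ∀ h ∈ H, h z = z)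
    (hT₁H : ∀ h ∈ H, ∀ z ∈ T₁, h z ∈ T₁) (S₀ : Subring E) [IsNoetherianRing S₀]
    (hS₀K : S₀ ≤ K.toSubring) (t₀ : Finset E) (hT₁gen : T₁ = Subring.closure ((S₀ : Set E) ∪ t₀)) :
    IsNoetherianRing (T₁ ⊓ K.toSubring : Subring E) := by
  obtain ⟨t, -, ht⟩ := exists_finset_inf_fixed_eq_closure H K T₁ h1 hmul hK hT₁H S₀ hS₀K t₀ hT₁gen
  have hadj : (Algebra.adjoin S₀ (t : Set E)).toSubring = Subring.closure ((S₀ : Set E) ∪ t) := by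
    rw [Algebra.adjoin_eq_ring_closure]
    congr 1
    ext z
    simp only [Set.mem_union, Set.mem_range, SetLike.mem_coe]
    constructor
    · rintro (⟨w, rfl⟩ | hz)
      · exact Or.inl w.2
      · exact Or.inr hz
    · rintro (hz | hz)
      · exact Or.inl ⟨⟨z, hz⟩, rfl⟩
      · exact Or.inr hz
  have hN : IsNoetherianRing (Algebra.adjoin S₀ (t : Set E)).toSubring :=
    isNoetherianRing_toSubring_of_fg _ (Subalgebra.fg_adjoin_finset _)
  rw [hadj, ← ht] at hN
  exact hN

/-- **INVARIANT DESCENT, MODEL FORM.**  As `isRegularLocalRing_locAtCentre_inf_fixed`, with the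
Noetherian hypothesis discharged by Artin–Tate: `T₁ = S₀[t₀]` finitely generated over a Noetherian subring
`S₀ ⊆ K` (e.g. the image of the constant field). [folklore] -/
theorem isRegularLocalRing_locAtCentre_inf_fixed_of_fg (h1 : (1 : E ≃+* E) ∈ H)
    (hmul : ∀ g ∈ H, ∀ h ∈ H, g * h ∈ H) (hK : ∀ z, z ∈ K ↔ ∀ h ∈ H, h z = z)
    (hT₁O : T₁ ≤ OE.toSubring) (hT₁H : ∀ h ∈ H, ∀ z ∈ T₁, h z ∈ T₁)
    (hfrac : ∀ z : E, ∃ a ∈ T₁, ∃ b ∈ T₁, b ≠ 0 ∧ z = a / b)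
    (hreg : IsRegularLocalRing (locAtCentre T₁ OE))
    (S₀ : Subring E) [IsNoetherianRing S₀] (hS₀K : S₀ ≤ K.toSubring) (t₀ : Finset E)
    (hT₁gen : T₁ = Subring.closure ((S₀ : Set E) ∪ t₀))
    {x : E} (hx : x ∈ T₁) (hsep : ∀ h ∈ H, h ≠ 1 → OE.valuation (x - h x) = 1)
    (hgen : ∀ z : E, ∃ p : E[X], (∀ i, p.coeff i ∈ K) ∧ z = p.eval x) :
    IsRegularLocalRing (locAtCentre (T₁ ⊓ K.toSubring) OE) := by
  haveI := isNoetherianRing_inf_fixed H K T₁ h1 hmul hK hT₁H S₀ hS₀K t₀ hT₁gen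
  haveI : IsNoetherianRing (locAtCentre (T₁ ⊓ K.toSubring) OE) :=
    isNoetherianRing_locAtCentre OE ((inf_le_left : T₁ ⊓ K.toSubring ≤ T₁).trans hT₁O)
  exact isRegularLocalRing_locAtCentre_inf_fixed OE H K T₁ h1 hmul hK hT₁O hT₁H hfrac hreg hx hsep hgen

end ArtinTate

end Summit.ResolutionOfSingularities.ResolutionOfSingularities.Theorems.InvariantDescentLU
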